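import Mathlib
import HarnessLib
import Summits.ValiantsHypothesis.ValiantsHypothesis.Theorems.LacunarySymmetroidMatrixDescartesProductPlusOneEulerSectorsTop
import Summits.ValiantsHypothesis.ValiantsHypothesis.Theorems.LacunarySymmetroidMatrixDescartesProductPlusOneCoherentK

/-!
# ValiantsHypothesis / LacunarySymmetroid — crux `MatrixDescartes` (stmt-ValiantsHypothesis-18050, V1),
# LINE (A) «product_plus_one», S5 Euler currency: the coherent one-zero sector for every K — TOP coupling (mirror)

`x ↦ 1/x` companion of ✓ `eulerBound_coherentK` (p667023): factors with their single sign change at the BOTTOM letter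
(`a_{j,K−1}·a_{j,l} > 0` for `l ≥ 1`, `a_{j,K−1}·a_{j,0} < 0`), TOP coupling `l₀ = K−1`, every format `K ≥ 3`, every strictly increasing support:
`Z₊(eulerNumerator d a ⟨K−1,_⟩) ≤ 2m + 1` — via ✓ `card_pos_roots_euler_le_reverse` (general K) and the letter re-indexing `l ↦ K−1−l`.
Honest framing: sector rung; `stub_polyLaw` / 18050 / B OPEN; `VP ≠ VNP` NOT proved.  No definitions, no named facts.
-/

set_option linter.dupNamespace false

namespace Summit.ValiantsHypothesis.ValiantsHypothesis.Theorems.LacunarySymmetroidMatrixDescartes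

namespace ProductPlusOne

open Polynomial Finset
open scoped BigOperators

/-- ★ **The coherent one-zero sector at the TOP coupling, every format.** [this file's theorem] -/
theorem eulerBound_coherentK_top {m K : ℕ} (hK : 3 ≤ K) (d : Fin K → ℕ) (hd : StrictMono d) (a : Fin m → Fin K → ℝ)
    (hcoh : ∀ j (l : Fin K), 0 < (l : ℕ) → 0 < a j ⟨K - 1, by omega⟩ * a j l)
    (hbot : ∀ j, a j ⟨K - 1, by omega⟩ * a j ⟨0, by omega⟩ < 0) :
    ((∑ j, (∑ l, C (a j l * ((d l : ℝ) - d ⟨K - 1, by omega⟩)) * X ^ (d l)) * ∏ i ∈ Finset.univ.erase j, (∑ l, C (a i l) * X ^ (d l))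
      : ℝ[X]).roots.toFinset.filter (fun t => 0 < t)).card ≤ 2 * m + 1 := by
  classical
  set top : Fin K := ⟨K - 1, by omega⟩ with htop
  set D : ℕ := d top with hDdef
  have hD : ∀ l, d l ≤ D := fun l => hd.monotone (Fin.mk_le_mk.mpr (by have := l.isLt; omega) : l ≤ top)
  refine (card_pos_roots_euler_le_reverse d D hD a top).trans ?_
  -- re-index the letters by `Fin.rev`
  set σ : Equiv.Perm (Fin K) := Fin.revPerm with hσ
  set d' : Fin K → ℕ := fun l => D - d (σ l) with hd'
  set a' : Fin m → Fin K → ℝ := fun j l => a j (σ l) with ha'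
  have hσ0 : σ ⟨0, by omega⟩ = top := by
    rw [hσ, htop]; ext; simp [Fin.revPerm_apply, Fin.rev]
  have hσtop : σ top = ⟨0, by omega⟩ := by
    rw [hσ, htop]; ext; simp [Fin.revPerm_apply, Fin.rev]; omega
  have hσsymm : σ.symm top = ⟨0, by omega⟩ := by
    rw [Equiv.symm_apply_eq]; exact hσ0.symm
  have hre := eulerNumerator_reindex σ (fun l => D - d l) a top
  -- the reversed numerator equals the re-indexed form (which is `eulerNumerator d' a' 0` unfolded)
  have hcast : ∀ l : Fin K, (((D - d l : ℕ) : ℝ)) = ((fun l => D - d l) l : ℕ) := fun l => rfl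
  have hd'mono : StrictMono d' := by
    intro i j hij
    simp only [hd']
    have h1 : σ j < σ i := by
      rw [hσ]; simp only [Fin.revPerm_apply]; exact Fin.rev_lt_rev.mpr hij
    have h2 : d (σ j) < d (σ i) := hd h1
    have h3 : d (σ i) ≤ D := hD _
    omega
  have key := eulerBound_coherentK (m := m) hK d' hd'mono a'
    (fun j l hl => by
      simp only [ha']
      rw [hσ0]
      refine hcoh j (σ l) ?_
      -- `σ l ≠ top`… i.e. `(σ l : ℕ) > 0` iff `l < K - 1`
      rw [hσ]; simp only [Fin.revPerm_apply, Fin.val_rev]; omega)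
    (fun j => by simp only [ha']; rw [hσ0, hσtop]; exact hbot j)
  -- match the shapes
  have hshape : (∑ j, (∑ l, C (a j l * (((D - d l : ℕ) : ℝ) - ((D - d top : ℕ) : ℝ))) * X ^ (D - d l))
        * ∏ i ∈ Finset.univ.erase j, (∑ l, C (a i l) * X ^ (D - d l)) : ℝ[X])
      = ∑ j, (∑ l, C (a' j l * ((d' l : ℝ) - d' ⟨0, by omega⟩)) * X ^ (d' l))
          * ∏ i ∈ Finset.univ.erase j, (∑ l, C (a' i l) * X ^ (d' l)) := by
    rw [← hre]
    simp only [ha', hd', hσsymm]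
  rw [hshape]
  exact key

/-- ★ **Members, both extreme couplings, every format**: under the hypotheses of `eulerBound_coherentK_top`, every member
`C c·X^{m·d_{K−1}} + ∏_j f_j` has at most `2m + 2` positive zeros (✓ `card_pos_roots_class_le_euler`). [this file's corollary] -/
theorem coherentK_sector_class_top {m K : ℕ} (hK : 3 ≤ K) (d : Fin K → ℕ) (hd : StrictMono d) (a : Fin m → Fin K → ℝ)
    (hcoh : ∀ j (l : Fin K), 0 < (l : ℕ) → 0 < a j ⟨K - 1, by omega⟩ * a j l)
    (hbot : ∀ j, a j ⟨K - 1, by omega⟩ * a j ⟨0, by omega⟩ < 0) (c : ℝ) :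
    ((C c * X ^ (m * d ⟨K - 1, by omega⟩) + ∏ j, ∑ l, C (a j l) * X ^ (d l) : ℝ[X]).roots.toFinset.filter (fun t => 0 < t)).card
      ≤ 2 * m + 2 :=
  (card_pos_roots_class_le_euler d a ⟨K - 1, by omega⟩ c).trans
    (by have := eulerBound_coherentK_top hK d hd a hcoh hbot; omega)

/-- ★ **Members at the bottom coupling, every format** (hypotheses of ✓ `eulerBound_coherentK`): at most `2m + 2` positive zeros.
(The sign-aware `m + 2` is p7 g14's ✓ `coherent_sector_classK_signed`.) [this file's corollary] -/
theorem coherentK_sector_class_bottom {m K : ℕ} (hK : 3 ≤ K) (d : Fin K → ℕ) (hd : StrictMono d) (a : Fin m → Fin K → ℝ)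
    (hcoh : ∀ j (l : Fin K), (l : ℕ) < K - 1 → 0 < a j ⟨0, by omega⟩ * a j l)
    (htop : ∀ j, a j ⟨0, by omega⟩ * a j ⟨K - 1, by omega⟩ < 0) (c : ℝ) :
    ((C c * X ^ (m * d ⟨0, by omega⟩) + ∏ j, ∑ l, C (a j l) * X ^ (d l) : ℝ[X]).roots.toFinset.filter (fun t => 0 < t)).card
      ≤ 2 * m + 2 :=
  (card_pos_roots_class_le_euler d a ⟨0, by omega⟩ c).trans
    (by have := eulerBound_coherentK hK d hd a hcoh htop; omega)

end ProductPlusOne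

end Summit.ValiantsHypothesis.ValiantsHypothesis.Theorems.LacunarySymmetroidMatrixDescartes
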